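import Summits.HodgeConjecture.HodgeConjecture.Theorems.VHCAbelianSchemesRoadSecantQuotientAnchorPinnedDefs
import Summits.HodgeConjecture.HodgeConjecture.Theorems.VHCAbelianSchemesRoadRegimeSplit
import Literature.AlgebraicGeometry.HodgeTheory.TwistedPerfectAdmissibilityInitialSegment
import HarnessLib

/-!
# Road b02 (`VHCAbelianSchemesRoad`, D-0059) — the PINNED `(6,3)` anchored-carrier statement (a″′) and residual (b″′) READ AT
# THE PRIMED TWISTED DOOR `tw(AdmTw′)`, `AdmTw′ := gluableSigmaAdmissible ∨ bfSingleAdmissible′` (door-prime package R9.3 §iii,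
# «optional sugar»; skeleton v3.2 of the re-keyed crux `SemiregularSheafRepresentativesTwPrimeAtDiag`)

research route conditional on HC_CM; not a corollary; Q11.4-sentence-2 already refuted in dim ≥ 3.

DEFINITIONS AND FACT-FREE GLUE ONLY (`HC_CM` nowhere; no cell, carrier, residual, K-SR♭∃, VHC, `HC_AV` or HC asserted; no claim-tagged
fact imported). The door-slice audit (ab-andre-2 g60, d8fc261a885387a8) found the BF disjunct of the road's twisted door typed on arbitrary
index sets `I`, while print (Buchweitz–Flenner Thm. 5.1 with Pridham Cor. 2.25 ∕ Rem. 2.26: `σ^{B₀}_q = Σ_{i ≤ q} (B₀^i ∕ i!) ∪ σ_{q−i}` is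
unipotent lower-triangular, so the joint kernels agree ON INITIAL SEGMENTS) supports it only for `{q | q + 1 ∈ I}` downward closed; the
repair is the primed notion `bfSingleAdmissible′ := bfSingleAdmissible ∧ I.IsShiftedInitialSegment`
(`Literature/…/TwistedPerfectAdmissibilityInitialSegment`, p537197) and the primed door `AdmTw′`. Director-hodge g9 R9.3 ∕ R9.4 and ring-2
LEAD 157's `DOOR-PRIME-PACKAGE.md` (36e61c73e912c4e1) re-key the deciding crux to its reading at `tw(AdmTw′)`; the package's skeleton v3.2
spells the two `(6,3)` stubs over the 𝒪-generic `AnchoredCarrierAt` ∕ `LefAtExceptionalRegimeAtUnder` at the pinned anchor data, because the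
names `SecantQuotient{AnchorCarrier,Residual}63Pinned C` of `…SecantQuotientAnchorPinnedDefs` (p-landed, v3.1) are DEFINED over `tw(AdmTw)`.
THIS file supplies the primed names (§iii last bullet of the package) — NEW NAMES ONLY, nothing of v3.1 edited:

* §1 `SecantQuotientAnchorCarrier63PinnedPrime C` := `AnchoredCarrierAt (tw C AdmTw′) 6 3 𝔄^pin 𝔖^pin` (a″′) and
  `SecantQuotientResidual63PinnedPrime C` := `LefAtExceptionalRegimeAtUnder (tw C AdmTw′) 6 3 (¬ HasServedFibre 6 3 𝔄^pin 𝔖^pin)` (b″′) —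
  the §3 definitions of `…PinnedDefs` VERBATIM with `bfSingleAdmissible′` for `bfSingleAdmissible`; both `@[conjecture]`, OPEN, HYPOTHESES
  wherever used (the skeleton's stubs 2a″′ ∕ 2b″′ by name).
* §2 door monotonicity of the two 𝒪-generic predicates (both are ∃-statements over the door: a bigger door makes them easier) — folklore
  bookkeeping stated for any `𝒪 ≤ 𝒪′` (the rung's monotonicity is the landed `LefAtExceptionalRegimeSixfoldMiddle.mono` of `…RegimeSplit`).
* §3 fact-free glue by name at the primed door: (a″′) ∧ (b″′) ⟹ the primed `(6,3)` rung `LefAtExceptionalRegimeSixfoldMiddle (tw C AdmTw′)`;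
  the primed rung ⟹ (b″′) (same AA-b ∕ AA-d names as v3 ∕ v3.1).
* §4 COMPARISON with v3.1 (honest bookkeeping of what the primed door moves): `tw C AdmTw′ ⊆ tw C AdmTw`
  (`twistedReflexiveClass_or_bfSingle_of_or_bfSingle'`), hence **(a″′) ⟹ (a″)**, **(b″′) ⟹ (b″)** and primed rung ⟹ rung: the primed
  statements are the STRONGER ones (content moves INTO the deciding crux: carriers must be `AdmTw′`-admissible — σ-disjunct with
  `{1,…,n} ⊆ I`, or BF data on an initial segment); NEITHER converse is claimed. Mixed form (a″′) ∧ (b″) ⟹ rung.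

What is NOT claimed: (a″′), (b″′), (a″), (b″), any cell, rung, crux, K-SR♭∃, VHC, `HC_AV`, HC; any converse of §4; that `𝔄^pin` is
inhabited. References: [cite: Markman2025SecantWeil, §1.5 (p. 7), Thm. 1.4.1, Thm. 1.5.1, §9.2 Prop. 9.2.2 and Lemma 9.3.11]
[cite: Bloch1972Semiregularity, Remark (7.5)] [cite: BuchweitzFlenner2003, §5 Thm. 5.1] [cite: Pridham2024Semiregularity, Cor. 2.25 and
Rem. 2.26] [cite: vanGeemen1994HodgeAV, §2.4, Thm. 4.11 and 5.4].
-/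

noncomputable section

open CategoryTheory CategoryTheory.Limits AlgebraicGeometry Topology

namespace Summit.HodgeConjecture.HodgeConjecture.Ring2.SemiregularRepresentatives

set_option linter.dupNamespace false -- the cell's namespace repeats the summit name, as in every `Ring2*` file

open Literature.AlgebraicGeometry Literature.AlgebraicGeometry.Motives Literature.AlgebraicGeometry.Motives.AbelianVariety
open Literature.AlgebraicGeometry.HodgeTheory Literature.AlgebraicGeometry.Markman2025
open Literature.AlgebraicTopology.SingularHomology
open Summit.Ventures.HSemireg (ObjClass)

/-! ## §1 The `(6,3)` PINNED anchored-carrier statement (a″′) and PINNED residual (b″′) for the PRIMED twisted door `tw C AdmTw′` -/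

/-- **(a″′) THE PINNED SECANT–QUOTIENT ANCHORED-CARRIER STATEMENT at `(6,3)` for the PRIMED twisted door `tw C AdmTw′`**,
`AdmTw′ := gluableSigmaAdmissible ∨ bfSingleAdmissible′` (`SecantQuotientAnchorCarrier63PinnedPrime C`): at every PINNED anchor
`(X, e^*h_Y(θ₀))` and every pinned served rational class `γ`, an `AdmTw′`-admissible `B`-twisted bounded complex of vector bundles ON `X`
(σ-door with the cell clause `{1,…,6} ⊆ I`, or Buchweitz–Flenner data on an INITIAL SEGMENT `{q | q+1 ∈ I}`) with `κ₃ = a·γ + c₃·θ³`, `a ≠ 0`,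
`κ_k = c_k·θᵏ` (`k ∈ I ∖ {3}`) — `AnchoredCarrierAt` at `(𝔄^pin, 𝔖^pin)`; the statement (a″) of `…PinnedDefs` §3 with `bfSingleAdmissible′`
for `bfSingleAdmissible`, i.e. skeleton v3.2's stub 2a″′ by name. STRONGER than (a″) (§4). CITATION-EXPECTED from a PREPRINT at print's
anchors in print's direction (arXiv:2502.03415 Thm. 1.4.1 + §1.5 + Lemma 9.3.11; Markman's reflexive secant sheaves are SHEAVES, `B₀`-twisted,
with semiregularity in Buchweitz–Flenner's sense on the initial segment `{0,…,p}` — the primed BF disjunct is the one print supports);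
OPEN; WHY IT MIGHT FAIL: as for (a″) — special (hyperelliptic) curves, served directions other than `κ₃(𝓔̄)`'s (gaps (G1), (G3)) — and, newly,
a carrier admissible only on a NON-initial index set would serve (a″) but not (a″′). A HYPOTHESIS wherever used.
[cite: Markman2025SecantWeil, Thm. 1.4.1, §1.5, §9.2 Prop. 9.2.2 and Lemma 9.3.11] [cite: Bloch1972Semiregularity, Remark (7.5)]
[cite: BuchweitzFlenner2003, §5 Thm. 5.1] [cite: Pridham2024Semiregularity, Cor. 2.25 and Rem. 2.26] -/
@[conjecture] def SecantQuotientAnchorCarrier63PinnedPrime (C : ChernCharacterBetti) : Prop :=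
  AnchoredCarrierAt (Literature.AlgebraicGeometry.HodgeTheory.twistedReflexiveClass C
      (fun n X₀ I E => Summit.Ventures.HSemireg.gluableSigmaAdmissible n X₀ I E ∨
        Literature.AlgebraicGeometry.HodgeTheory.bfSingleAdmissible' n X₀ I E)) 6 3
    (fun X θ ↦ secantQuotientAnchorsPinned X θ) (fun X θ ↦ secantQuotientServedClassesPinned X θ)

/-- **(b″′) THE PINNED SECANT–QUOTIENT RESIDUAL at `(6,3)` for the PRIMED twisted door** (`SecantQuotientResidual63PinnedPrime C`): the cell
`LefAtExceptionalRegimeAt (tw C AdmTw′) 6 3` RESTRICTED to the one-parameter abelian sixfold pencils `(f, W)` with NO PINNED-served fibre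
(`¬ HasServedFibre 6 3 𝔄^pin 𝔖^pin f W`); the statement (b″) of `…PinnedDefs` §3 with `bfSingleAdmissible′` for `bfSingleAdmissible`, i.e.
skeleton v3.2's stub 2b″′ (T3 designate) by name. STRONGER than (b″) (§4: the representatives it asks for must be `AdmTw′`-admissible).
Implied by the primed rung fact-free (§3); NOT known to imply it. OPEN; a HYPOTHESIS wherever used.
[cite: vanGeemen1994HodgeAV, §2.4, Thm. 4.11 and 5.4] [cite: Markman2025SecantWeil, §1.5 and Thm. 1.5.1] [cite: Bloch1972Semiregularity, Remark (7.5)]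
[cite: BuchweitzFlenner2003, §5 Thm. 5.1] -/
@[conjecture] def SecantQuotientResidual63PinnedPrime (C : ChernCharacterBetti) : Prop :=
  LefAtExceptionalRegimeAtUnder (Literature.AlgebraicGeometry.HodgeTheory.twistedReflexiveClass C
      (fun n X₀ I E => Summit.Ventures.HSemireg.gluableSigmaAdmissible n X₀ I E ∨
        Literature.AlgebraicGeometry.HodgeTheory.bfSingleAdmissible' n X₀ I E)) 6 3
    (fun _ _ f W ↦ ¬ HasServedFibre 6 3 (fun X θ ↦ secantQuotientAnchorsPinned X θ)
      (fun X θ ↦ secantQuotientServedClassesPinned X θ) f W)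

/-! ## §2 Door monotonicity of the two 𝒪-generic predicates (folklore bookkeeping) -/

section Mono

variable {𝒪 𝒪' : ObjClass} {n p : ℕ} {𝔄 : ∀ X : SchemeOver ℂ, complexBetti X 2 → Prop}
  {𝔖 : ∀ (X : SchemeOver ℂ), complexBetti X 2 → Set (complexBetti X (2 * p))}
  {P : ∀ ⦃𝒳 S : SchemeOver ℂ⦄, (𝒳 ⟶ S) → complexBetti 𝒳 (2 * p) → Prop}

/-- **The anchored-carrier statement is MONOTONE in the door**: a carrier admissible for `𝒪` is admissible for any `𝒪′ ⊇ 𝒪`.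
[folklore] [cite: Bloch1972Semiregularity, Remark (7.5)] -/
theorem anchoredCarrierAt_mono_door (h𝒪 : ∀ n X₀ I κ, 𝒪 n X₀ I κ → 𝒪' n X₀ I κ) (h : AnchoredCarrierAt 𝒪 n p 𝔄 𝔖) :
    AnchoredCarrierAt 𝒪' n p 𝔄 𝔖 := by
  intro X θ hX w hw hwQ
  obtain ⟨I, κ, a, c, hpI, hκ, ha, hκp, hκq⟩ := h X θ hX w hw hwQ
  exact ⟨I, κ, a, c, hpI, h𝒪 _ _ _ _ hκ, ha, hκp, hκq⟩

/-- **The conditional cell is MONOTONE in the door** (its conclusion asks for an `𝒪`-admissible datum at some fibre).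
[folklore] [cite: vanGeemen1994HodgeAV, §2.4] [cite: Bloch1972Semiregularity, Remark (7.5)] -/
theorem under_mono_door (h𝒪 : ∀ n X₀ I κ, 𝒪 n X₀ I κ → 𝒪' n X₀ I κ) (h : LefAtExceptionalRegimeAtUnder 𝒪 n p P) :
    LefAtExceptionalRegimeAtUnder 𝒪' n p P := by
  intro 𝒳 S f hf h𝒳 hirr haff hsm hdim hab hsec W hW s₀ halg hexc hP
  obtain ⟨s₁, I, κ, V, a, Z, hpI, hκ, ha, hZ, hVp, hκV, hVH⟩ := h f hf h𝒳 hirr haff hsm hdim hab hsec W hW s₀ halg hexc hP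
  exact ⟨s₁, I, κ, V, a, Z, hpI, h𝒪 _ _ _ _ hκ, ha, hZ, hVp, hκV, hVH⟩

end Mono

/-- **The primed door is a sub-door of the door of record**, as an inclusion of object classes:
`tw C AdmTw′ ≤ tw C AdmTw` (`bfSingleAdmissible′ ⟹ bfSingleAdmissible`). [cite: BuchweitzFlenner2003, §5 Thm. 5.1]
[cite: Pridham2024Semiregularity, Cor. 2.25 and Rem. 2.26] -/
theorem twistedReflexiveClass_admTw'_le_admTw (C : ChernCharacterBetti) :
    ∀ n X₀ I κ, Literature.AlgebraicGeometry.HodgeTheory.twistedReflexiveClass C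
        (fun n X₀ I E => Summit.Ventures.HSemireg.gluableSigmaAdmissible n X₀ I E ∨
          Literature.AlgebraicGeometry.HodgeTheory.bfSingleAdmissible' n X₀ I E) n X₀ I κ →
      Literature.AlgebraicGeometry.HodgeTheory.twistedReflexiveClass C
        (fun n X₀ I E => Summit.Ventures.HSemireg.gluableSigmaAdmissible n X₀ I E ∨
          Literature.AlgebraicGeometry.HodgeTheory.bfSingleAdmissible n X₀ I E) n X₀ I κ :=
  fun _ _ _ _ h ↦ twistedReflexiveClass_or_bfSingle_of_or_bfSingle' C h

/-! ## §3 Fact-free glue by name at the primed door: (a″′) ∧ (b″′) ⟹ primed rung; primed rung ⟹ (b″′) -/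

/-- **(a″′) ∧ (b″′) ⟹ the PRIMED `(6,3)` rung** `∀ C, LefAtExceptionalRegimeSixfoldMiddle (tw C AdmTw′)` (skeleton v3.2's
`rung_sixfoldMiddleTwPrime`, by `lefAtExceptionalRegimeSixfoldMiddle_of_anchoredCarrierAt_of_under_not`). [cite: Markman2025SecantWeil, Thm. 1.4.1 and Thm. 1.5.1]
[cite: Bloch1972Semiregularity, Remark (7.5)] [cite: vanGeemen1994HodgeAV, Thm. 4.11] -/
theorem rung_sixfoldMiddleTwPrime_of_secantQuotientAnchorCarrier63PinnedPrime_of_residual63PinnedPrime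
    (hA : ∀ C : ChernCharacterBetti, SecantQuotientAnchorCarrier63PinnedPrime C)
    (hR : ∀ C : ChernCharacterBetti, SecantQuotientResidual63PinnedPrime C) :
    ∀ C : ChernCharacterBetti, LefAtExceptionalRegimeSixfoldMiddle (Literature.AlgebraicGeometry.HodgeTheory.twistedReflexiveClass C
      (fun n X₀ I E => Summit.Ventures.HSemireg.gluableSigmaAdmissible n X₀ I E ∨
        Literature.AlgebraicGeometry.HodgeTheory.bfSingleAdmissible' n X₀ I E)) :=
  fun C ↦ lefAtExceptionalRegimeSixfoldMiddle_of_anchoredCarrierAt_of_under_not (hA C) (hR C)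

/-- Pointwise form: (a″′) and (b″′) at ONE Chern character theory `C` give the primed rung at `C`. [cite: Markman2025SecantWeil, Thm. 1.4.1 and Thm. 1.5.1]
[cite: Bloch1972Semiregularity, Remark (7.5)] -/
theorem lefAtExceptionalRegimeSixfoldMiddle_twPrime_of_pinnedPrime {C : ChernCharacterBetti}
    (hA : SecantQuotientAnchorCarrier63PinnedPrime C) (hR : SecantQuotientResidual63PinnedPrime C) :
    LefAtExceptionalRegimeSixfoldMiddle (Literature.AlgebraicGeometry.HodgeTheory.twistedReflexiveClass C
      (fun n X₀ I E => Summit.Ventures.HSemireg.gluableSigmaAdmissible n X₀ I E ∨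
        Literature.AlgebraicGeometry.HodgeTheory.bfSingleAdmissible' n X₀ I E)) :=
  lefAtExceptionalRegimeSixfoldMiddle_of_anchoredCarrierAt_of_under_not hA hR

/-- **The primed rung ⟹ (b″′)** (a residual is a cell under an extra hypothesis). [cite: vanGeemen1994HodgeAV, §2.4] [cite: Bloch1972Semiregularity, Remark (7.5)] -/
theorem secantQuotientResidual63PinnedPrime_of_rung_sixfoldMiddleTwPrime {C : ChernCharacterBetti}
    (h : LefAtExceptionalRegimeSixfoldMiddle (Literature.AlgebraicGeometry.HodgeTheory.twistedReflexiveClass C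
      (fun n X₀ I E => Summit.Ventures.HSemireg.gluableSigmaAdmissible n X₀ I E ∨
        Literature.AlgebraicGeometry.HodgeTheory.bfSingleAdmissible' n X₀ I E))) :
    SecantQuotientResidual63PinnedPrime C :=
  under_of_lefAtExceptionalRegimeAt _ (lefAtExceptionalRegimeSixfoldMiddle_iff_at.1 h)

/-! ## §4 Comparison with v3.1: `tw C AdmTw′ ⊆ tw C AdmTw`; (a″′) ⟹ (a″); (b″′) ⟹ (b″); primed rung ⟹ rung -/

/-- **(a″′) ⟹ (a″)**: a carrier admissible for the primed door is admissible for the door of record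
(`anchoredCarrierAt_mono_door` along `twistedReflexiveClass_admTw'_le_admTw`). The converse is NOT claimed.
[cite: BuchweitzFlenner2003, §5 Thm. 5.1] [cite: Markman2025SecantWeil, Thm. 1.4.1] -/
theorem secantQuotientAnchorCarrier63Pinned_of_prime {C : ChernCharacterBetti} (h : SecantQuotientAnchorCarrier63PinnedPrime C) :
    SecantQuotientAnchorCarrier63Pinned C :=
  anchoredCarrierAt_mono_door (twistedReflexiveClass_admTw'_le_admTw C) h

/-- **(b″′) ⟹ (b″)**: a primed residual cell yields representatives in the door of record (`under_mono_door`). The converse is NOT claimed.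
[cite: vanGeemen1994HodgeAV, §2.4] [cite: BuchweitzFlenner2003, §5 Thm. 5.1] -/
theorem secantQuotientResidual63Pinned_of_prime {C : ChernCharacterBetti} (h : SecantQuotientResidual63PinnedPrime C) :
    SecantQuotientResidual63Pinned C :=
  under_mono_door (twistedReflexiveClass_admTw'_le_admTw C) h

/-- **Primed rung ⟹ rung of record** at every `C`. [cite: vanGeemen1994HodgeAV, §2.4 and Thm. 4.11] [cite: BuchweitzFlenner2003, §5 Thm. 5.1] -/
theorem lefAtExceptionalRegimeSixfoldMiddle_tw_of_twPrime {C : ChernCharacterBetti}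
    (h : LefAtExceptionalRegimeSixfoldMiddle (Literature.AlgebraicGeometry.HodgeTheory.twistedReflexiveClass C
      (fun n X₀ I E => Summit.Ventures.HSemireg.gluableSigmaAdmissible n X₀ I E ∨
        Literature.AlgebraicGeometry.HodgeTheory.bfSingleAdmissible' n X₀ I E))) :
    LefAtExceptionalRegimeSixfoldMiddle (Literature.AlgebraicGeometry.HodgeTheory.twistedReflexiveClass C
      (fun n X₀ I E => Summit.Ventures.HSemireg.gluableSigmaAdmissible n X₀ I E ∨
        Literature.AlgebraicGeometry.HodgeTheory.bfSingleAdmissible n X₀ I E)) :=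
  LefAtExceptionalRegimeSixfoldMiddle.mono (twistedReflexiveClass_admTw'_le_admTw C) h

/-- **(a″′) ∧ (b″′) ⟹ the `(6,3)` rung OF RECORD** `∀ C, LefAtExceptionalRegimeSixfoldMiddle (tw C AdmTw)` (skeleton v3.1's
`stub_rung_sixfoldMiddleTw` statement): the primed pair also serves the aside item. [cite: Markman2025SecantWeil, Thm. 1.4.1 and Thm. 1.5.1]
[cite: Bloch1972Semiregularity, Remark (7.5)] [cite: vanGeemen1994HodgeAV, Thm. 4.11] -/
theorem rung_sixfoldMiddleTw_of_secantQuotientAnchorCarrier63PinnedPrime_of_residual63PinnedPrime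
    (hA : ∀ C : ChernCharacterBetti, SecantQuotientAnchorCarrier63PinnedPrime C)
    (hR : ∀ C : ChernCharacterBetti, SecantQuotientResidual63PinnedPrime C) :
    ∀ C : ChernCharacterBetti, LefAtExceptionalRegimeSixfoldMiddle (Literature.AlgebraicGeometry.HodgeTheory.twistedReflexiveClass C
      (fun n X₀ I E => Summit.Ventures.HSemireg.gluableSigmaAdmissible n X₀ I E ∨
        Literature.AlgebraicGeometry.HodgeTheory.bfSingleAdmissible n X₀ I E)) :=
  fun C ↦ lefAtExceptionalRegimeSixfoldMiddle_tw_of_twPrime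
    (lefAtExceptionalRegimeSixfoldMiddle_twPrime_of_pinnedPrime (hA C) (hR C))

/-- Mixed form **(a″′) ∧ (b″) ⟹ the rung of record** (primed carriers, residual of record). [cite: Markman2025SecantWeil, Thm. 1.4.1 and Thm. 1.5.1]
[cite: Bloch1972Semiregularity, Remark (7.5)] -/
theorem rung_sixfoldMiddleTw_of_secantQuotientAnchorCarrier63PinnedPrime_of_residual63Pinned
    (hA : ∀ C : ChernCharacterBetti, SecantQuotientAnchorCarrier63PinnedPrime C)
    (hR : ∀ C : ChernCharacterBetti, SecantQuotientResidual63Pinned C) :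
    ∀ C : ChernCharacterBetti, LefAtExceptionalRegimeSixfoldMiddle (Literature.AlgebraicGeometry.HodgeTheory.twistedReflexiveClass C
      (fun n X₀ I E => Summit.Ventures.HSemireg.gluableSigmaAdmissible n X₀ I E ∨
        Literature.AlgebraicGeometry.HodgeTheory.bfSingleAdmissible n X₀ I E)) :=
  rung_sixfoldMiddleTw_of_secantQuotientAnchorCarrier63Pinned_of_residual63Pinned
    (fun C ↦ secantQuotientAnchorCarrier63Pinned_of_prime (hA C)) hR

end Summit.HodgeConjecture.HodgeConjecture.Ring2.SemiregularRepresentatives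

end
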